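import Mathlib
import HarnessLib
import Summits.Langlands.Statement
import Summits.Langlands.Langlands.Theses.SkinnerWilesDefectOne
import Literature.NumberTheory.GaloisRepresentations.OrdinaryGaloisRep
import Literature.NumberTheory.GaloisRepresentations.GaloisRep
import Literature.NumberTheory.GaloisRepresentations.HeckeCharacter
import Literature.NumberTheory.Automorphic.AutomorphicInductionCharacter
import Literature.NumberTheory.Automorphic.ReciprocityGLn
import Literature.FieldTheory.AlgClosed.PadicAlgClEquivComplex
import Summits.Langlands.Langlands.Theses.SymmetryTypeSplit
set_option linter.dupNamespace false
set_option linter.unusedVariables false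
set_option linter.unusedSectionVars false

/-!
# Birth skeleton (BC3) for crux `SymmetryTypeSplit.OddDescentProModular` — line `birth` (AFTER-BIRTH form: the route decl BY NAME)

Route `SymmetryTypeSplit` (decomp-langlands lens-2 g18; child route refining route `SkinnerWilesDefectOne`).  The crux is
the ODD-DESCENT cell of the host ENGINE E (stmt-Langlands-12919): E's text VERBATIM with `¬ IsSelfTwist ρ → IsOddDescent ρ` inserted.  Layer 2 = the three odd-descent stubs of the target cell ∧ the EXIT-CONVERSE dictionary.

Shape (for `ledger skeleton check` / `#h21_check_skeleton`): stubs `theorem stub_<name> : <signature> := by sorry` (each a layer-2 piece of the cell —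
no stub restates the cell, the host items X / E or the summit: probes B6 of the node kit), `namespace _Goal` with `def stub_<name> : Prop := type_of% @stub_<name>`
naming each statement, and the kernel-checked composition `OddDescentProModular_of (h₁ : _Goal.stub_…) … : <the crux BY NAME>`.
`lean check --json`: rc 0, sorries = the stubs (4), none elsewhere.
After birth this AFTER-BIRTH form (route decl BY NAME via `import Summits.Langlands.Langlands.Theses.SymmetryTypeSplit`) is published with
`ledger crux write <item> Lines/birth.lean --file <this file>` + `ledger skeleton check $(ledger crux dir <item>)/Lines/birth.lean --crux <item>`.
-/

namespace Summit.Langlands.Langlands.Cruxes.OddDescentProModular.Birth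

open scoped NumberField
open Filter IsDedekindDomain Literature.NumberTheory.GaloisRepresentations Literature.NumberTheory.Automorphic

-- the crux BY NAME: `Summit.Langlands.Langlands.Theses.SymmetryTypeSplit.OddDescentProModular` (the born route file).

/-- oriented-ordinary clause ⟹ `IsOrdinaryOfWeightAt` (the one line of the host's glue). -/
theorem ordinaryOfWeight_of_oriented {F : Type} [Field F] [NumberField F] {p : ℕ} [Fact p.Prime]
    (ρ : FramedGaloisRep F (PadicAlgCl p) 2) {O : ValuationSubring (PadicAlgCl p)}
    (ρ₀ : Field.absoluteGaloisGroup F →* Matrix.GeneralLinearGroup (Fin 2) O)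
    (hord : (∃ k : ℕ, 2 ≤ k ∧ ∃ m : ℕ, 0 < m ∧ ∀ v : IsDedekindDomain.HeightOneSpectrum (NumberField.RingOfIntegers F), (p : NumberField.RingOfIntegers F) ∈ v.asIdeal → Literature.NumberTheory.GaloisRepresentations.IsPDistinguishedAt ρ₀ v ∧ ∃ Q : Matrix.GeneralLinearGroup (Fin 2) (PadicAlgCl p), Valued.v (Q.val 0 0) ≤ Valued.v (Q.val 1 0) ∧ ∀ σ, (Q⁻¹ * ρ.toLocal v σ * Q).val 1 0 = 0 ∧ (σ ∈ Literature.NumberTheory.GaloisRepresentations.absInertia (v.adicCompletion F) → (Q⁻¹ * ρ.toLocal v σ * Q).val 1 1 ^ m = 1 ∧ (Q⁻¹ * ρ.toLocal v σ * Q).val 0 0 ^ m = algebraMap (Padic p) (PadicAlgCl p) (((Literature.NumberTheory.GaloisRepresentations.GaloisRep.cyclotomicCharacter (v.adicCompletion F) p σ).val : PadicInt p) : Padic p) ^ ((k - 1) * m)))) :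
    ∃ k : ℕ, 2 ≤ k ∧ ∃ m : ℕ, 0 < m ∧ ∀ v : HeightOneSpectrum (𝓞 F), (p : 𝓞 F) ∈ v.asIdeal → ρ.IsOrdinaryOfWeightAt p v k m := by
  obtain ⟨k, hk, m, hm, hv⟩ := hord
  refine ⟨k, hk, m, hm, fun v hpv => ?_⟩
  obtain ⟨-, Q, -, hQ⟩ := hv v hpv
  exact (FramedGaloisRep.isOrdinaryOfWeightAt_iff_padicAlgCl p ρ v k m).mpr ⟨Q, hQ⟩


/-- primes above `p` are finitely many. -/
theorem finite_setOf_natCast_mem {F : Type} [Field F] [NumberField F] {p : ℕ} (hp : p ≠ 0) :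
    {v : HeightOneSpectrum (𝓞 F) | ((p : ℕ) : 𝓞 F) ∈ v.asIdeal}.Finite := by
  have h : Ideal.span {((p : ℕ) : 𝓞 F)} ≠ ⊥ := by
    rw [ne_eq, Ideal.span_singleton_eq_bot]
    exact_mod_cast hp
  refine (Ideal.finite_factors h).subset fun v hv => ?_
  exact Ideal.dvd_iff_le.mpr ((Ideal.span_singleton_le_iff_mem _).mpr hv)



/-- stub · `stub_oddDescentClassicalOverQ` — OBC-1 · Skinner–Wiles over ℚ, untwisted: for ρ in the sector with ρ = ν ⊗ ρ'|Γ_F (ρ' odd, ν finite order, ρ not self-twisted) the descended ρ' is Satake–Frobenius compatible with a cuspidal π on GL₂(𝔸_ℚ) of regular L-algebraic infinity type.  Why plausibly true: SkinnerWiles1999 §1 Theorem p. 6 [ℚ: (i) p-distinguished, (ii) D_p-ordinary, (iii) det ρ' = ψε^{k-1} odd ⟹ ρ' from a newform] for ρ̄' reducible, SkinnerWiles2001 (nearly ordinary residually irreducible distinguished deformations are modular) for ρ̄' irreducible — ordinarity, distinguishedness and irreducibility of ρ' are inherited from ρ = ν ⊗ ρ'|Γ_F up to a finite-order twist at p (modularity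 over ℚ is twist-stable), oddness is the stratum hypothesis; Deligne–Carayol give the newform's π.  ORDINARY OVER ℚ_p (critic row 256, write-up for the stub author): if p splits in F, ρ'|Γ_{ℚ_p} = ν_v⁻¹ ⊗ ρ|Γ_{F_v} is nearly ordinary p-distinguished; if p is inert or ramified, the Γ_{F_v}-stable line is Γ_{ℚ_p}-stable — otherwise ρ'|Γ_{ℚ_p} ≅ Ind ψ from F_v and ψ, ψ^c would both carry inertia weight k − 1 ≥ 1, contradicting the finite-order lower-right inertia character of the sector — so ρ' is nearly ordinary p-distinguished over ℚ in all cases (the finite local twist globalises).  RESIDUAL DICHOTOMY: ρ̄|Γ_F reducible forces ρ̄' REDUCIBLE (⟹ SkinnerWiles1999) OR DIHEDRAL ρ̄' ≅ Ind_F^ℚ χ̄ (irreducible over ℚ, reducible on Γ_F ⟹ SkinnerWiles2001 / Kisin / Pan 2022, NOT SW99; degenerate corner: ρ̄'|Γ_{ℚ(ζ_p)} reducible only if F = ℚ(√−p) ⊂ ℚ(ζ_p), i.e. p ≡ 3 mod 4 and F = ℚ(√−p), and p = 3) — the ℚ-engine Literature fact (census I-g18.4) must list both branches and the corner, or the corner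 is carved out of OBC into the residual.  Why it might fail: the dihedral corner F = ℚ(√−p) / p = 3; the twist normalisation at p.  Size: L (assembling print). -/
theorem stub_oddDescentClassicalOverQ :
    ∀ (F : Type) [Field F] [NumberField F], NumberField.IsTotallyComplex F → Module.finrank ℚ F = 2 → ∀ (p : ℕ) [Fact p.Prime], p ≠ 2 → ∀ (O : ValuationSubring (PadicAlgCl p)), O = (Valued.v : Valuation (PadicAlgCl p) NNReal).valuationSubring → ∀ (ι : PadicAlgCl p ≃+* ℂ) (ρ : Literature.NumberTheory.GaloisRepresentations.FramedGaloisRep F (PadicAlgCl p) 2) (ρ₀ : Field.absoluteGaloisGroup F →* Matrix.GeneralLinearGroup (Fin 2) O), ρ.toGaloisRep.IsIrreducible → (∀ᶠ v in cofinite, ρ.IsUnramifiedAt v) → ρ.HasUpperTriangularIntegralModel ρ₀ → (∃ k : ℕ, 2 ≤ k ∧ ∃ m : ℕ, 0 < m ∧ ∀ v : IsDedekindDomain.HeightOneSpectrum (NumberField.RingOfIntegers F), (p : NumberField.RingOfIntegers F) ∈ v.asIdeal → Literature.NumberTheory.GaloisRepresentations.IsPDistinguishedAt ρ₀ v ∧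 ∃ Q : Matrix.GeneralLinearGroup (Fin 2) (PadicAlgCl p), Valued.v (Q.val 0 0) ≤ Valued.v (Q.val 1 0) ∧ ∀ σ, (Q⁻¹ * ρ.toLocal v σ * Q).val 1 0 = 0 ∧ (σ ∈ Literature.NumberTheory.GaloisRepresentations.absInertia (v.adicCompletion F) → (Q⁻¹ * ρ.toLocal v σ * Q).val 1 1 ^ m = 1 ∧ (Q⁻¹ * ρ.toLocal v σ * Q).val 0 0 ^ m = algebraMap (Padic p) (PadicAlgCl p) (((Literature.NumberTheory.GaloisRepresentations.GaloisRep.cyclotomicCharacter (v.adicCompletion F) p σ).val : PadicInt p) : Padic p) ^ ((k - 1) * m))) → ¬ (∃ (η : Field.absoluteGaloisGroup F →ₜ* (PadicAlgCl p)ˣ) (P : Matrix.GeneralLinearGroup (Fin 2) (PadicAlgCl p)), (∃ σ : Field.absoluteGaloisGroup F, η σ ≠ 1) ∧ ∀ σ : Field.absoluteGaloisGroup F, ((η σ : (PadicAlgCl p)ˣ) : PadicAlgCl p) • (ρ σ).val = (P * ρ σ * P⁻¹).val) → ∀ (ρ' : Literature.NumberTheory.GaloisRepresentations.FramedGaloisRep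 ℚ (PadicAlgCl p) 2) (ν : Field.absoluteGaloisGroup F →ₜ* (PadicAlgCl p)ˣ), ρ'.IsOdd → (∃ n : ℕ, 0 < n ∧ ∀ σ, ν σ ^ n = 1) → (∀ σ : Field.absoluteGaloisGroup F, (ρ σ).val = ((ν σ : (PadicAlgCl p)ˣ) : PadicAlgCl p) • (ρ' (Literature.NumberTheory.GaloisRepresentations.absGaloisRestrict ℚ F σ)).val) → ∀ (hcptQ : Literature.NumberTheory.Automorphic.isCompact_glFiniteIntegralLevel 2 ℚ), ∃ (π : Literature.NumberTheory.Automorphic.CuspidalAutomorphicRepData 2 ℚ hcptQ) (T : Literature.NumberTheory.Automorphic.InfinityType ℚ 2), π.1.HasInfinityType T ∧ T.IsLAlgebraic ∧ T.IsRegular ∧ ∀ᶠ w in cofinite, Summit.Langlands.SatakeFrobCompatibleAt ι π.1 ρ' w := by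
  sorry

/-- stub · `stub_finiteOrderCharacterUnramifiedAE` — OBC-2 · a finite-order continuous p-adic character ν of Γ_F kills the inertia subgroups at almost every place (open kernel ⟹ finite Galois splitting field ⟹ unramified outside its discriminant).  Folklore; size M (Mathlib: `Ideal.inertia`, `primesAbove`, finiteness of ramified primes in a finite extension). -/
theorem stub_finiteOrderCharacterUnramifiedAE :
    ∀ (F : Type) [Field F] [NumberField F] (p : ℕ) [Fact p.Prime] (ν : Field.absoluteGaloisGroup F →ₜ* (PadicAlgCl p)ˣ), (∃ n : ℕ, 0 < n ∧ ∀ σ, ν σ ^ n = 1) → ∀ᶠ v : IsDedekindDomain.HeightOneSpectrum (NumberField.RingOfIntegers F) in Filter.cofinite, ∀ 𝔓 ∈ v.primesAbove, ∀ σ ∈ 𝔓.inertia (Field.absoluteGaloisGroup F), ν σ = 1 := by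
  sorry

/-- stub · `stub_quadraticBaseChangeTwistTransport` — OBC-3 · quadratic base change + finite-order twist, Satake–Frobenius compatible off a finite S ⊇ {v ∣ p} ∪ {r ramified} ∪ {ν ramified} — VERBATIM the conclusion of the tree's LANDED conditional theorem `Theorems.SkinnerWilesDefectOne.EisensteinProModularSeed.stub_quadraticBaseChangeTwist` (facts: `baseChange_cyclic_cuspidal` Langlands 1980 / Arthur–Clozel 4.2(a), `ArthurClozel1989_strongLifting_archimedean` 5.1, `Langlands1980_quadraticBaseChange_frobCompatible` + Carayol).  Size: closed modulo three print facts. -/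
theorem stub_quadraticBaseChangeTwistTransport :
    ∀ (F : Type) [Field F] [NumberField F], NumberField.IsTotallyComplex F → Module.finrank ℚ F = 2 → ∀ (p : ℕ) [Fact p.Prime] (hcptQ : Literature.NumberTheory.Automorphic.isCompact_glFiniteIntegralLevel 2 ℚ) (ι : PadicAlgCl p ≃+* ℂ) (π : Literature.NumberTheory.Automorphic.CuspidalAutomorphicRepData 2 ℚ hcptQ) (T : Literature.NumberTheory.Automorphic.InfinityType ℚ 2), π.1.HasInfinityType T → T.IsLAlgebraic → T.IsRegular → ∀ (ρ' : Literature.NumberTheory.GaloisRepresentations.FramedGaloisRep ℚ (PadicAlgCl p) 2), (∀ᶠ w in Filter.cofinite, Summit.Langlands.SatakeFrobCompatibleAt ι π.1 ρ' w) → ∀ (ν : Field.absoluteGaloisGroup F →ₜ* (PadicAlgCl p)ˣ), (∃ n : ℕ, 0 < n ∧ ∀ σ, ν σ ^ n = 1) → ∀ (r : Literature.NumberTheory.GaloisRepresentations.FramedGaloisRep F (PadicAlgCl p) 2), (∀ σ, (r σ).val = ((ν σ : (PadicAlgCl p)ˣ) : PadicAlgCl p) • (ρ' (Literature.NumberTheory.GaloisRepresentations.absGaloisRestrict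 ℚ F σ)).val) → r.toGaloisRep.IsIrreducible → ∀ (S : Set (IsDedekindDomain.HeightOneSpectrum (NumberField.RingOfIntegers F))), S.Finite → (∀ v : IsDedekindDomain.HeightOneSpectrum (NumberField.RingOfIntegers F), (p : NumberField.RingOfIntegers F) ∈ v.asIdeal → v ∈ S) → (∀ v ∉ S, r.IsUnramifiedAt v) → (∀ v ∉ S, ∀ 𝔓 ∈ v.primesAbove, ∀ σ ∈ 𝔓.inertia (Field.absoluteGaloisGroup F), ν σ = 1) → ∀ hcptF : Literature.NumberTheory.Automorphic.isCompact_glFiniteIntegralLevel 2 F, ∃ (πF : Literature.NumberTheory.Automorphic.CuspidalAutomorphicRepData 2 F hcptF) (T' : Literature.NumberTheory.Automorphic.InfinityType F 2), πF.1.HasInfinityType T' ∧ T'.IsLAlgebraic ∧ T'.IsRegular ∧ ∀ v ∉ S, Summit.Langlands.SatakeFrobCompatibleAt ι πF.1 r v := by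
  sorry

/-- stub · `stub_classicalOrdinaryProModular` — DICT · the EXIT CONVERSE (support, print): a classically automorphic irreducible ρ, ordinary of parallel weight k ≥ 2 above p, is p-adically automorphic of some tame level (Eichler–Shimura–Harder: regular L-algebraic cuspidal π on GL₂/F is cohomological; Emerton 2006 Thm 0.7 / Hida: classical cohomological eigensystems are points of the completed Hecke algebra 𝕋(𝒰)) — the host EXIT 12921 with hypothesis and conclusion swapped.  Why it might fail: only through the typing of `IsPadicallyAutomorphic` (dense tame level vs the level of π).  Size: L. -/
theorem stub_classicalOrdinaryProModular :
    ∀ (F : Type) [Field F] [NumberField F], NumberField.IsTotallyComplex F → Module.finrank ℚ F = 2 → ∀ (p : ℕ) [Fact p.Prime], p ≠ 2 → ∀ (hcpt : Literature.NumberTheory.Automorphic.isCompact_glFiniteIntegralLevel 2 F) (ι : PadicAlgCl p ≃+* ℂ) (ρ : Literature.NumberTheory.GaloisRepresentations.FramedGaloisRep F (PadicAlgCl p) 2), ρ.toGaloisRep.IsIrreducible → (∀ᶠ v in cofinite, ρ.IsUnramifiedAt v) → (∃ k : ℕ, 2 ≤ k ∧ ∃ m : ℕ, 0 < m ∧ ∀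 v : IsDedekindDomain.HeightOneSpectrum (NumberField.RingOfIntegers F), (p : NumberField.RingOfIntegers F) ∈ v.asIdeal → ρ.IsOrdinaryOfWeightAt p v k m) → (∃ π : Literature.NumberTheory.Automorphic.CuspidalAutomorphicRepData 2 F hcpt, π.1.IsLAlgebraic ∧ ∀ᶠ v in cofinite, Summit.Langlands.SatakeFrobCompatibleAt ι π.1 ρ v) → ∃ 𝒰 : Literature.NumberTheory.Automorphic.BigHeckeGLn.TameLevel 2 F p, 𝒰.IsPadicallyAutomorphic ρ := by
  sorry

namespace _Goal

/-- the statement of `stub_oddDescentClassicalOverQ` as a named Prop. -/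
def stub_oddDescentClassicalOverQ : Prop :=
  type_of% @Summit.Langlands.Langlands.Cruxes.OddDescentProModular.Birth.stub_oddDescentClassicalOverQ

/-- the statement of `stub_finiteOrderCharacterUnramifiedAE` as a named Prop. -/
def stub_finiteOrderCharacterUnramifiedAE : Prop :=
  type_of% @Summit.Langlands.Langlands.Cruxes.OddDescentProModular.Birth.stub_finiteOrderCharacterUnramifiedAE

/-- the statement of `stub_quadraticBaseChangeTwistTransport` as a named Prop. -/
def stub_quadraticBaseChangeTwistTransport : Prop :=
  type_of% @Summit.Langlands.Langlands.Cruxes.OddDescentProModular.Birth.stub_quadraticBaseChangeTwistTransport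

/-- the statement of `stub_classicalOrdinaryProModular` as a named Prop. -/
def stub_classicalOrdinaryProModular : Prop :=
  type_of% @Summit.Langlands.Langlands.Cruxes.OddDescentProModular.Birth.stub_classicalOrdinaryProModular

end _Goal

/-- **`OddDescentProModular` from the 4 stubs** (kernel-checked, no sorry): the hypotheses are, by name, the statements of the stubs; the conclusion is the route decl `Summit.Langlands.Langlands.Theses.SymmetryTypeSplit.OddDescentProModular`. -/
theorem OddDescentProModular_of (h1 : _Goal.stub_oddDescentClassicalOverQ) (h2 : _Goal.stub_finiteOrderCharacterUnramifiedAE) (h3 : _Goal.stub_quadraticBaseChangeTwistTransport) (h4 : _Goal.stub_classicalOrdinaryProModular) :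
    Summit.Langlands.Langlands.Theses.SymmetryTypeSplit.OddDescentProModular := by
  have ha : type_of% @stub_oddDescentClassicalOverQ := h1
  have hb : type_of% @stub_finiteOrderCharacterUnramifiedAE := h2
  have hc : type_of% @stub_quadraticBaseChangeTwistTransport := h3
  have hd : type_of% @stub_classicalOrdinaryProModular := h4
  intro F _ _ hF hdeg p _ hp O hO ρ ρ₀ hirr hunr hmod hord hst hobc
  obtain ⟨ι⟩ := PadicAlgCl.nonempty_ringEquiv_complex p
  refine hd F hF hdeg p hp (Literature.NumberTheory.Automorphic.isCompact_glFiniteIntegralLevel_holds 2 F) ι ρ hirr hunr (ordinaryOfWeight_of_oriented ρ ρ₀ hord) ?_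
  obtain ⟨ρ', ν, hodd, hfin, hr⟩ := hobc
  obtain ⟨π, T, hT, hTL, hTR, hcompat⟩ :=
    ha F hF hdeg p hp O hO ι ρ ρ₀ hirr hunr hmod hord hst ρ' ν hodd hfin hr (Literature.NumberTheory.Automorphic.isCompact_glFiniteIntegralLevel_holds 2 ℚ)
  have hν := hb F p ν hfin
  set S : Set (IsDedekindDomain.HeightOneSpectrum (𝓞 F)) := {v | ((p : ℕ) : 𝓞 F) ∈ v.asIdeal} ∪ {v | ¬ ρ.IsUnramifiedAt v} ∪
    {v | ¬ ∀ 𝔓 ∈ v.primesAbove, ∀ σ ∈ 𝔓.inertia (Field.absoluteGaloisGroup F), ν σ = 1} with hS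
  have hSfin : S.Finite :=
    ((finite_setOf_natCast_mem (Fact.out : p.Prime).ne_zero).union (Filter.eventually_cofinite.mp hunr)).union (Filter.eventually_cofinite.mp hν)
  obtain ⟨πF, T', hT', hT'L, -, hcomp⟩ := hc F hF hdeg p (Literature.NumberTheory.Automorphic.isCompact_glFiniteIntegralLevel_holds 2 ℚ) ι π T hT hTL hTR
    ρ' hcompat ν hfin ρ hr hirr S hSfin (fun v hv => Or.inl (Or.inl hv)) (fun v hv => by_contra fun h => hv (Or.inl (Or.inr h)))
    (fun v hv => by_contra fun h => hv (Or.inr h)) (Literature.NumberTheory.Automorphic.isCompact_glFiniteIntegralLevel_holds 2 F)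
  exact ⟨πF, ⟨T', hT', hT'L⟩, Filter.mem_of_superset hSfin.compl_mem_cofinite fun v hv => hcomp v hv⟩

/-- By-name sanity check (an `example`, not a declaration of the file): the stubs feed the composition as they stand. -/
example : Summit.Langlands.Langlands.Theses.SymmetryTypeSplit.OddDescentProModular :=
  OddDescentProModular_of stub_oddDescentClassicalOverQ stub_finiteOrderCharacterUnramifiedAE stub_quadraticBaseChangeTwistTransport stub_classicalOrdinaryProModular

/-- Hypothesis-free assembly (operator recipe for `skeleton check`: a theorem concluding the crux BY NAME, assembled from the sorried `stub_*` theorems — it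
inherits their `sorry`, nothing else). -/
theorem OddDescentProModular_proof : Summit.Langlands.Langlands.Theses.SymmetryTypeSplit.OddDescentProModular :=
  OddDescentProModular_of stub_oddDescentClassicalOverQ stub_finiteOrderCharacterUnramifiedAE stub_quadraticBaseChangeTwistTransport stub_classicalOrdinaryProModular

end Summit.Langlands.Langlands.Cruxes.OddDescentProModular.Birth
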